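import Literature.AlgebraicGeometry.Motives.CurveThroughTwoPointsTwoCharts
import Literature.AlgebraicGeometry.HodgeTheory.QuasiProjectiveOfAffine
import Literature.AlgebraicGeometry.Resolution.ChowLemmaGeneralProofs
import Literature.AlgebraicGeometry.Resolution.QuasiProjectiveChowCover
import HarnessLib

/-!
# Two points of an irreducible scheme lie on a curve (Mumford) — non-separated ambient schemes

Topic `Literature/AlgebraicGeometry/Motives` (family `hodge`). PROOF FILE (theorems only; no
definition, no named fact). Third instalment of the tree's forms of Mumford's lemma (*Abelian
Varieties*, §6, Lemma: "Any two points of an irreducible variety `X` lie on an irreducible curve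
`C` on `X`"): `Motives/CurveThroughTwoPointsProofs` proves it for AFFINE ambient schemes,
`Motives/CurveThroughTwoPointsSeparated` for SEPARATED ones (via Chow's lemma), and this file drops
the separatedness hypothesis altogether:

* `mumford_smoothCurve_through_two_points_of_isIntegral` — for an INTEGRAL `ℂ`-scheme `X` locally
  of finite type (not necessarily separated or quasi-compact) and any two complex points `a`, `b` of
  `X` (not necessarily distinct) there are a smooth irreducible affine curve `C`, a `ℂ`-morphism
  `g : C → X` and complex points `a'`, `b'` of `C` over `a`, `b`;
* `mumford_smoothCurve_through_two_points_of_irreducibleSpace_of_smooth` — the same for `X` smooth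
  and irreducible (the typing of the bases of the Mumford–Tate families of
  `Summits/HodgeConjecture/…/Ring2Hypotheses`: smooth, irreducible, NOT assumed separated).

The printed lemma is about varieties (separated), and a non-separated `X` receives no proper
surjection from a separated scheme, so Chow's lemma does not reduce to the separated case. Proof
(ours; every step classical): take affine opens `U ∋ a`, `V ∋ b`, `W = U ∩ V ≠ ∅`, projective
compactifications `j_U : U ↪ P_U`, `j_V : V ↪ P_V` (`HodgeTheory.IsQuasiProjectiveOver.of_isAffine`)
and the scheme-theoretic image `Z` of `W ↪ P_U ×_ℂ P_V` — the "closure of the graph" of Chow's lemma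
(Görtz–Wedhorn Thm. 13.100, Step 3; the tree's `Resolution.ChowLemmaProof.isIso_morphismRestrict`:
`π₁ : Z → P_U` is an isomorphism over `j_U(W)`). `Z` is integral and projective (Segre), `π₁`, `π₂`
have closed images containing the dense `j_U(W)`, `j_V(W)`, so complex points `z_a`, `z_b` of `Z` lie
over `j_U(a)`, `j_V(b)`, inside a common affine open `T ⊆ Z` (Liu 3.3.36 (b)). The two CHARTS
`π₁⁻¹(j_U U) → U ⊆ X` and `π₂⁻¹(j_V V) → V ⊆ X` agree on `π₁⁻¹(j_U W)`; the two-charts lemma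
(`TwoCharts.exists_smoothCurve_through_two_charts_of_isAffineOpen`,
`Motives/CurveThroughTwoPointsTwoCharts`: glue after the integral base change
`Spec Γ(T)[λ, μ]/(λ² − λ − φμ)`, then the separated two-point lemma) finishes.

What is still NOT here: other algebraically closed fields; the conclusion as a closed irreducible
curve `D ⊆ X` (only the normalised form).

## References

* [MumfordAV1970] D. Mumford, Abelian Varieties, TIFR Studies in Math. 5, OUP 1970, §6, Lemma.
* [GortzWedhorn2020] U. Görtz, T. Wedhorn, Algebraic Geometry I, 2nd ed. 2020, Thm. 13.100 (proof,
  Step 3: closure of the graph).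
* [Liu2002] Q. Liu, Algebraic Geometry and Arithmetic Curves, OUP 2002, Prop. 3.3.36 (b).
-/

noncomputable section

open CategoryTheory CategoryTheory.Limits AlgebraicGeometry TopologicalSpace MonoidalCategory
open Literature.AlgebraicGeometry.HodgeTheory (IsQuasiProjectiveOver)
open Literature.AlgebraicGeometry.Resolution

namespace Literature.AlgebraicGeometry.Motives

/-- A complex point of `Y` whose underlying point is in the image of a `ℂ`-morphism `f : X → Y` of
`ℂ`-schemes locally of finite type lifts to a complex point of `X` (the fibre is a non-empty closed
subset of the Jacobson space `X`, hence contains a closed point). [folklore] -/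
private theorem exists_map_eq_of_mem_range {X Y : SchemeOver ℂ} (f : X ⟶ Y)
    [LocallyOfFiniteType X.hom] [LocallyOfFiniteType Y.hom] (P : ComplexPoints Y)
    (hP : P.pt ∈ Set.range f.left) : ∃ Q : ComplexPoints X, AlgPoints.map f Q = P := by
  haveI : JacobsonSpace ↥X.left := LocallyOfFiniteType.jacobsonSpace X.hom
  have hcl : IsClosed (f.left ⁻¹' ({P.pt} : Set Y.left)) :=
    (ComplexPoints.isClosed_pt P).preimage f.left.continuous
  obtain ⟨x, hx⟩ := hP
  obtain ⟨q, hq, hqc⟩ := nonempty_inter_closedPoints (X := ↥X.left) ⟨x, hx⟩ hcl.isLocallyClosed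
  refine ⟨(ComplexPoints.equivClosedPoints X).symm ⟨q, hqc⟩, ?_⟩
  apply (ComplexPoints.equivClosedPoints Y).injective
  apply Subtype.ext
  rw [ComplexPoints.coe_equivClosedPoints_apply, ComplexPoints.coe_equivClosedPoints_apply,
    AlgPoints.pt_map, ComplexPoints.pt_equivClosedPoints_symm_apply]
  exact Set.mem_singleton_iff.mp (Set.mem_preimage.mp hq)

/-- **Mumford's two-point lemma without separatedness.** For an integral `ℂ`-scheme `X` locally of
finite type and complex points `a`, `b` of `X` there are a smooth irreducible affine `ℂ`-scheme `C`
of topological Krull dimension `1`, a `ℂ`-morphism `g : C ⟶ X` and complex points `a'`, `b'` of `C`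
with `g a' = a`, `g b' = b`. (Printed for varieties, i.e. separated `X`; the separatedness is
removed here by the closure-of-the-graph correspondence of Chow's lemma between projective
compactifications of two affine charts and the two-charts gluing lemma — see the module docstring.)
[cite: MumfordAV1970, §6, Lemma] [cite: GortzWedhorn2020, Thm. 13.100] [cite: Liu2002, Prop. 3.3.36 (b)] -/
theorem mumford_smoothCurve_through_two_points_of_isIntegral {X : SchemeOver ℂ} [IsIntegral X.left]
    [LocallyOfFiniteType X.hom] (a b : ComplexPoints X) :
    ∃ (C : SchemeOver ℂ) (g : C ⟶ X) (a' b' : ComplexPoints C),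
      IsAffine C.left ∧ IrreducibleSpace C.left ∧ AlgebraicGeometry.Smooth C.hom ∧
        topologicalKrullDim C.left = 1 ∧ AlgPoints.map g a' = a ∧ AlgPoints.map g b' = b := by
  classical
  /- Step 1: affine opens `U ∋ a`, `V ∋ b`, their projective compactifications. -/
  obtain ⟨U, hU, haU, -⟩ := exists_isAffineOpen_mem_and_subset (U := ⊤) (x := a.pt) trivial
  obtain ⟨V, hV, hbV, -⟩ := exists_isAffineOpen_mem_and_subset (U := ⊤) (x := b.pt) trivial
  let Uₒ : SchemeOver ℂ := openSubschemeOver X U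
  let Vₒ : SchemeOver ℂ := openSubschemeOver X V
  haveI : IsAffine Uₒ.left := hU
  haveI : IsAffine Vₒ.left := hV
  haveI : LocallyOfFiniteType Uₒ.hom := by
    change LocallyOfFiniteType (U.ι ≫ X.hom); infer_instance
  haveI : LocallyOfFiniteType Vₒ.hom := by
    change LocallyOfFiniteType (V.ι ≫ X.hom); infer_instance
  obtain ⟨PU, jU, hPU, hjU⟩ := IsQuasiProjectiveOver.of_isAffine Uₒ
  obtain ⟨PV, jV, hPV, hjV⟩ := IsQuasiProjectiveOver.of_isAffine Vₒ
  haveI : IsProper PU.hom := hPU.isProper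
  haveI : IsProper PV.hom := hPV.isProper
  -- Scheme-level names
  obtain ⟨jU₀, hjU₀⟩ : ∃ j : (U : Scheme) ⟶ PU.left, j = jU.left := ⟨_, rfl⟩
  obtain ⟨jV₀, hjV₀⟩ : ∃ j : (V : Scheme) ⟶ PV.left, j = jV.left := ⟨_, rfl⟩
  haveI : IsOpenImmersion jU₀ := by rw [hjU₀]; exact hjU
  haveI : IsOpenImmersion jV₀ := by rw [hjV₀]; exact hjV
  have hjUw : jU₀ ≫ PU.hom = U.ι ≫ X.hom := by rw [hjU₀]; exact Over.w jU
  have hjVw : jV₀ ≫ PV.hom = V.ι ≫ X.hom := by rw [hjV₀]; exact Over.w jV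
  /- Step 2: `W = U ∩ V` as an open of `U`, and the correspondence `e : W → P_U ×_ℂ P_V`. -/
  let WU : (U : Scheme).Opens := U.ι ⁻¹ᵁ V
  have hWU : (WU : Set (U : Scheme)).Nonempty := by
    obtain ⟨x, hxU, hxV⟩ := nonempty_preirreducible_inter U.isOpen V.isOpen ⟨_, haU⟩ ⟨_, hbV⟩
    exact ⟨⟨x, hxU⟩, hxV⟩
  have hrV : Set.range (WU.ι ≫ U.ι) ⊆ Set.range V.ι := by
    rintro _ ⟨w, rfl⟩
    rw [Scheme.Opens.range_ι]
    exact w.2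
  let rV : (WU : Scheme) ⟶ (V : Scheme) := IsOpenImmersion.lift V.ι (WU.ι ≫ U.ι) hrV
  have hrV' : rV ≫ V.ι = WU.ι ≫ U.ι := IsOpenImmersion.lift_fac _ _ _
  let U₀ : PU.left.Opens := jU₀ ''ᵁ WU
  let isoW := jU₀.isoImage WU
  have hU₀ι : isoW.inv ≫ WU.ι ≫ jU₀ = U₀.ι := jU₀.isoImage_inv_ι WU
  have hcompat : U₀.ι ≫ PU.hom = (isoW.inv ≫ rV ≫ jV₀) ≫ PV.hom := by
    rw [← hU₀ι, Category.assoc, Category.assoc, hjUw, Category.assoc, Category.assoc, hjVw,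
      reassoc_of% hrV']
  let e : (U₀ : Scheme) ⟶ pullback PU.hom PV.hom := pullback.lift U₀.ι (isoW.inv ≫ rV ≫ jV₀) hcompat
  have he₁ : e ≫ pullback.fst _ _ = U₀.ι := pullback.lift_fst _ _ _
  have he₂ : e ≫ pullback.snd _ _ = isoW.inv ≫ rV ≫ jV₀ := pullback.lift_snd _ _ _
  -- `e` is quasi-compact
  haveI : IsLocallyNoetherian PU.left := LocallyOfFiniteType.isLocallyNoetherian PU.hom
  haveI : QuasiCompact (e ≫ pullback.fst PU.hom PV.hom) := by rw [he₁]; infer_instance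
  haveI : QuasiCompact e := .of_comp e (pullback.fst PU.hom PV.hom)
  /- Step 3: the closure `Z` of the correspondence and its projections. -/
  let Z : Scheme := e.image
  let i : Z ⟶ pullback PU.hom PV.hom := e.imageι
  let π₁ : Z ⟶ PU.left := i ≫ pullback.fst _ _
  let π₂ : Z ⟶ PV.left := i ≫ pullback.snd _ _
  haveI : Nonempty (U₀ : Scheme) := by
    obtain ⟨w, hw⟩ := hWU
    exact ⟨isoW.hom ⟨w, hw⟩⟩
  haveI : IsIntegral (U₀ : Scheme) :=
    isIntegral_of_isOpenImmersion (isoW.inv ≫ WU.ι ≫ U.ι : (U₀ : Scheme) ⟶ X.left)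
  have hZint : IsIntegral Z := ChowLemmaProof.isIntegral_image e
  haveI := hZint
  have hiso : IsIso (π₁ ∣_ U₀) := ChowLemmaProof.isIso_morphismRestrict PU.hom PV.hom U₀ e he₁
  let Zₒ : SchemeOver ℂ := Over.mk (π₁ ≫ PU.hom)
  haveI : LocallyOfFiniteType Zₒ.hom := by
    change LocallyOfFiniteType ((e.imageι ≫ pullback.fst PU.hom PV.hom) ≫ PU.hom); infer_instance
  haveI : IsIntegral Zₒ.left := hZint
  let π₁ₒ : Zₒ ⟶ PU := Over.homMk π₁ rfl
  have hπ₂w : π₂ ≫ PV.hom = Zₒ.hom := by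
    change (e.imageι ≫ pullback.snd PU.hom PV.hom) ≫ PV.hom = (e.imageι ≫ pullback.fst PU.hom PV.hom) ≫ PU.hom
    rw [Category.assoc, Category.assoc, pullback.condition]
  let π₂ₒ : Zₒ ⟶ PV := Over.homMk π₂ hπ₂w
  /- Step 4: lifts of `a`, `b` to `U`, `V`; the ranges of `π₁`, `π₂`. -/
  haveI : IsOpenImmersion (openSubschemeOverι X U).left := inferInstanceAs (IsOpenImmersion U.ι)
  haveI : IsOpenImmersion (openSubschemeOverι X V).left := inferInstanceAs (IsOpenImmersion V.ι)
  have haU' : a.pt ∈ (openSubschemeOverι X U).left.opensRange := by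
    change a.pt ∈ U.ι.opensRange
    rwa [Scheme.Opens.opensRange_ι]
  have hbV' : b.pt ∈ (openSubschemeOverι X V).left.opensRange := by
    change b.pt ∈ V.ι.opensRange
    rwa [Scheme.Opens.opensRange_ι]
  let aU := AlgPoints.liftOfMemOpensRange (openSubschemeOverι X U) a haU'
  let bV := AlgPoints.liftOfMemOpensRange (openSubschemeOverι X V) b hbV'
  have haU₁ : AlgPoints.map (openSubschemeOverι X U) aU = a := AlgPoints.map_liftOfMemOpensRange _ _ _
  have hbV₁ : AlgPoints.map (openSubschemeOverι X V) bV = b := AlgPoints.map_liftOfMemOpensRange _ _ _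
  obtain ⟨ya, hya⟩ : ∃ y : (U : Scheme), y = aU.pt := ⟨_, rfl⟩
  obtain ⟨yb, hyb⟩ : ∃ y : (V : Scheme), y = bV.pt := ⟨_, rfl⟩
  have hsec₁ : e.toImage ≫ π₁ = U₀.ι := by
    change e.toImage ≫ e.imageι ≫ pullback.fst _ _ = _
    rw [Scheme.Hom.toImage_imageι_assoc, he₁]
  have hsec₂ : e.toImage ≫ π₂ = isoW.inv ≫ rV ≫ jV₀ := by
    change e.toImage ≫ e.imageι ≫ pullback.snd _ _ = _
    rw [Scheme.Hom.toImage_imageι_assoc, he₂]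
  -- `U`, `V` are irreducible
  haveI : Nonempty (U : Scheme) := ⟨⟨_, haU⟩⟩
  haveI : Nonempty (V : Scheme) := ⟨⟨_, hbV⟩⟩
  haveI : IsIntegral (U : Scheme) := isIntegral_of_isOpenImmersion U.ι
  haveI : IsIntegral (V : Scheme) := isIntegral_of_isOpenImmersion V.ι
  -- the range of `π₁` contains `j_U(U)`
  have hcl₁ : IsClosed (Set.range π₁) := by
    have h : IsClosedMap π₁ :=
      (pullback.fst PU.hom PV.hom).isClosedMap.comp e.imageι.isClosedEmbedding.isClosedMap
    exact h.isClosed_range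
  have hr₁ : Set.range jU₀ ⊆ Set.range π₁ := by
    have hdense : Dense (WU : Set (U : Scheme)) := WU.isOpen.dense hWU
    have h1 : Set.range jU₀ ⊆ closure (U₀ : Set PU.left) := by
      rintro _ ⟨u, rfl⟩
      refine image_closure_subset_closure_image jU₀.continuous ⟨u, ?_, rfl⟩
      rw [hdense.closure_eq]
      trivial
    have h2 : (U₀ : Set PU.left) ⊆ Set.range π₁ := fun u hu =>
      ⟨e.toImage ⟨u, hu⟩, by rw [← Scheme.Hom.comp_apply, hsec₁]; rfl⟩
    exact h1.trans (hcl₁.closure_subset_iff.mpr h2)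
  -- the range of `π₂` contains `j_V(V)`
  have hcl₂ : IsClosed (Set.range π₂) := by
    have h : IsClosedMap π₂ :=
      (pullback.snd PU.hom PV.hom).isClosedMap.comp e.imageι.isClosedEmbedding.isClosedMap
    exact h.isClosed_range
  have hr₂ : Set.range jV₀ ⊆ Set.range π₂ := by
    -- `W` as an open of `V`, and its density
    let WV : (V : Scheme).Opens := V.ι ⁻¹ᵁ U
    have hWV : (WV : Set (V : Scheme)).Nonempty := by
      obtain ⟨w, hw⟩ := hWU
      exact ⟨⟨(U.ι w), hw⟩, w.2⟩
    have hdense : Dense (WV : Set (V : Scheme)) := WV.isOpen.dense hWV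
    have hrange : (WV : Set (V : Scheme)) ⊆ Set.range rV := by
      rintro v hv
      refine ⟨⟨⟨V.ι v, hv⟩, v.2⟩, V.ι.isOpenEmbedding.injective ?_⟩
      rw [← Scheme.Hom.comp_apply, hrV']
      rfl
    have h1 : Set.range jV₀ ⊆ closure (jV₀ '' (WV : Set (V : Scheme))) := by
      rintro _ ⟨v, rfl⟩
      refine image_closure_subset_closure_image jV₀.continuous ⟨v, ?_, rfl⟩
      rw [hdense.closure_eq]
      trivial
    have h2 : jV₀ '' (WV : Set (V : Scheme)) ⊆ Set.range π₂ := by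
      rintro _ ⟨v, hv, rfl⟩
      obtain ⟨w, rfl⟩ := hrange hv
      refine ⟨e.toImage (isoW.hom w), ?_⟩
      rw [← Scheme.Hom.comp_apply, hsec₂, Scheme.Hom.comp_apply, Scheme.hom_inv_apply,
        Scheme.Hom.comp_apply]
    exact h1.trans (hcl₂.closure_subset_iff.mpr h2)
  -- complex points of `Z` over `j_U(a)`, `j_V(b)`
  have hpa : (AlgPoints.map jU aU).pt = jU₀ ya := by rw [hjU₀, hya]; rfl
  have hpb : (AlgPoints.map jV bV).pt = jV₀ yb := by rw [hjV₀, hyb]; rfl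
  obtain ⟨zZa, hzZa⟩ := exists_map_eq_of_mem_range π₁ₒ (AlgPoints.map jU aU)
    (by rw [hpa]; exact hr₁ ⟨ya, rfl⟩)
  obtain ⟨zZb, hzZb⟩ := exists_map_eq_of_mem_range π₂ₒ (AlgPoints.map jV bV)
    (by rw [hpb]; exact hr₂ ⟨yb, rfl⟩)
  have hπ₁a : π₁ zZa.pt = jU₀ ya := by
    rw [← hpa, ← hzZa]; rfl
  have hπ₂b : π₂ zZb.pt = jV₀ yb := by
    rw [← hpb, ← hzZb]; rfl
  /- Step 5: the charts `A₁ = π₁⁻¹ j_U(U) → U → X`, `B₁ = π₂⁻¹ j_V(V) → V → X`. -/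
  let A₁ : Z.Opens := π₁ ⁻¹ᵁ jU₀.opensRange
  let B₁ : Z.Opens := π₂ ⁻¹ᵁ jV₀.opensRange
  let O₁ : Z.Opens := π₁ ⁻¹ᵁ U₀ ⊓ B₁
  have hO₁A : O₁ ≤ A₁ :=
    inf_le_left.trans (Scheme.Hom.preimage_mono π₁ (jU₀.image_le_opensRange WU))
  have hO₁B : O₁ ≤ B₁ := inf_le_right
  have hαr : Set.range (A₁.ι ≫ π₁) ⊆ Set.range jU₀ := by
    rintro _ ⟨z, rfl⟩
    exact z.2
  have hα₀ := IsOpenImmersion.lift_fac jU₀ (A₁.ι ≫ π₁) hαr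
  have wα : (IsOpenImmersion.lift jU₀ (A₁.ι ≫ π₁) hαr ≫ U.ι) ≫ X.hom =
      (openSubschemeOver Zₒ A₁).hom := by
    change (IsOpenImmersion.lift jU₀ (A₁.ι ≫ π₁) hαr ≫ U.ι) ≫ X.hom = A₁.ι ≫ π₁ ≫ PU.hom
    rw [Category.assoc, ← hjUw, reassoc_of% hα₀]
  let α₁ : openSubschemeOver Zₒ A₁ ⟶ X := Over.homMk _ wα
  have hβr : Set.range (B₁.ι ≫ π₂) ⊆ Set.range jV₀ := by
    rintro _ ⟨z, rfl⟩
    exact z.2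
  have hβ₀ := IsOpenImmersion.lift_fac jV₀ (B₁.ι ≫ π₂) hβr
  have wβ : (IsOpenImmersion.lift jV₀ (B₁.ι ≫ π₂) hβr ≫ V.ι) ≫ X.hom =
      (openSubschemeOver Zₒ B₁).hom := by
    change (IsOpenImmersion.lift jV₀ (B₁.ι ≫ π₂) hβr ≫ V.ι) ≫ X.hom = B₁.ι ≫ π₁ ≫ PU.hom
    rw [Category.assoc, ← hjVw, reassoc_of% hβ₀]
    change B₁.ι ≫ (e.imageι ≫ pullback.snd PU.hom PV.hom) ≫ PV.hom =
      B₁.ι ≫ (e.imageι ≫ pullback.fst PU.hom PV.hom) ≫ PU.hom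
    rw [Category.assoc, Category.assoc, ← pullback.condition]
  let β₁ : openSubschemeOver Zₒ B₁ ⟶ X := Over.homMk _ wβ
  /- Step 6: `α₁ = β₁` on `O₁`, through the section of `π₁` over `U₀`. -/
  have hW := ChowLemmaProof.range_subset_range_ι_of_preimage_eq_top _ _
    (ChowLemmaProof.toImage_preimage_eq_top' PU.hom PV.hom U₀ U₀ le_rfl e he₁)
  have hs₁ := IsOpenImmersion.lift_fac _ e.toImage hW
  have hs₂ : IsOpenImmersion.lift _ e.toImage hW ≫ (π₁ ∣_ U₀) = 𝟙 _ := by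
    rw [← cancel_mono U₀.ι, Category.assoc, morphismRestrict_ι, reassoc_of% hs₁]
    rw [hsec₁, Category.id_comp]
  have hs₃ : (π₁ ∣_ U₀) ≫ IsOpenImmersion.lift _ e.toImage hW = 𝟙 _ := by
    haveI := hiso
    rw [← IsIso.inv_eq_of_inv_hom_id hs₂, IsIso.hom_inv_id]
  have hkey : O₁.ι = (Z.homOfLE (inf_le_left : O₁ ≤ π₁ ⁻¹ᵁ U₀) ≫ (π₁ ∣_ U₀)) ≫ e.toImage := by
    rw [← hs₁, Category.assoc, reassoc_of% hs₃, Scheme.homOfLE_ι]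
  have hαβ₁ : Z.homOfLE hO₁A ≫ α₁.left = Z.homOfLE hO₁B ≫ β₁.left := by
    change Z.homOfLE hO₁A ≫ (IsOpenImmersion.lift jU₀ (A₁.ι ≫ π₁) hαr ≫ U.ι) =
      Z.homOfLE hO₁B ≫ (IsOpenImmersion.lift jV₀ (B₁.ι ≫ π₂) hβr ≫ V.ι)
    have hA : Z.homOfLE hO₁A ≫ IsOpenImmersion.lift jU₀ (A₁.ι ≫ π₁) hαr =
        (Z.homOfLE (inf_le_left : O₁ ≤ π₁ ⁻¹ᵁ U₀) ≫ (π₁ ∣_ U₀)) ≫ isoW.inv ≫ WU.ι := by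
      rw [← cancel_mono jU₀, Category.assoc, hα₀, Scheme.homOfLE_ι_assoc, hkey]
      simp only [Category.assoc, hsec₁, hU₀ι]
    have hB : Z.homOfLE hO₁B ≫ IsOpenImmersion.lift jV₀ (B₁.ι ≫ π₂) hβr =
        (Z.homOfLE (inf_le_left : O₁ ≤ π₁ ⁻¹ᵁ U₀) ≫ (π₁ ∣_ U₀)) ≫ isoW.inv ≫ rV := by
      rw [← cancel_mono jV₀, Category.assoc, hβ₀, Scheme.homOfLE_ι_assoc, hkey]
      simp only [Category.assoc, hsec₂]
    rw [reassoc_of% hA, reassoc_of% hB, hrV']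
  /- Step 7: `O₁` is non-empty. -/
  have hO₁ : (O₁ : Set Z).Nonempty := by
    obtain ⟨u₀⟩ := (inferInstance : Nonempty (U₀ : Scheme))
    refine ⟨e.toImage u₀, ?_, ?_⟩
    · change π₁ (e.toImage u₀) ∈ U₀
      rw [← Scheme.Hom.comp_apply, hsec₁]
      exact u₀.2
    · change π₂ (e.toImage u₀) ∈ jV₀.opensRange
      rw [← Scheme.Hom.comp_apply, hsec₂, Scheme.Hom.comp_apply, Scheme.Hom.comp_apply]
      exact ⟨_, rfl⟩
  /- Step 8: the complex points `za ∈ A₁(ℂ)`, `zb ∈ B₁(ℂ)` and their images. -/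
  haveI : IsOpenImmersion (openSubschemeOverι Zₒ A₁).left := inferInstanceAs (IsOpenImmersion A₁.ι)
  haveI : IsOpenImmersion (openSubschemeOverι Zₒ B₁).left := inferInstanceAs (IsOpenImmersion B₁.ι)
  have hzaA : zZa.pt ∈ (openSubschemeOverι Zₒ A₁).left.opensRange := by
    change zZa.pt ∈ A₁.ι.opensRange
    rw [Scheme.Opens.opensRange_ι]
    change π₁ zZa.pt ∈ jU₀.opensRange
    rw [hπ₁a]
    exact ⟨ya, rfl⟩
  have hzbB : zZb.pt ∈ (openSubschemeOverι Zₒ B₁).left.opensRange := by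
    change zZb.pt ∈ B₁.ι.opensRange
    rw [Scheme.Opens.opensRange_ι]
    change π₂ zZb.pt ∈ jV₀.opensRange
    rw [hπ₂b]
    exact ⟨yb, rfl⟩
  let za := AlgPoints.liftOfMemOpensRange (openSubschemeOverι Zₒ A₁) zZa hzaA
  let zb := AlgPoints.liftOfMemOpensRange (openSubschemeOverι Zₒ B₁) zZb hzbB
  have hza₁ : (za.pt.1 : Z) = zZa.pt := by
    change (AlgPoints.map (openSubschemeOverι Zₒ A₁) za).pt = zZa.pt
    rw [AlgPoints.map_liftOfMemOpensRange]
  have hzb₁ : (zb.pt.1 : Z) = zZb.pt := by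
    change (AlgPoints.map (openSubschemeOverι Zₒ B₁) zb).pt = zZb.pt
    rw [AlgPoints.map_liftOfMemOpensRange]
  have hαza : AlgPoints.map α₁ za = a := by
    apply (ComplexPoints.equivClosedPoints X).injective
    apply Subtype.ext
    rw [ComplexPoints.coe_equivClosedPoints_apply, ComplexPoints.coe_equivClosedPoints_apply]
    change U.ι (IsOpenImmersion.lift jU₀ (A₁.ι ≫ π₁) hαr za.pt) = a.pt
    have h1 : jU₀ (IsOpenImmersion.lift jU₀ (A₁.ι ≫ π₁) hαr za.pt) = jU₀ ya := by
      rw [← Scheme.Hom.comp_apply, hα₀, Scheme.Hom.comp_apply, Scheme.Opens.ι_apply, hza₁, hπ₁a]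
    rw [jU₀.isOpenEmbedding.injective h1, hya, ← haU₁]
    rfl
  have hβzb : AlgPoints.map β₁ zb = b := by
    apply (ComplexPoints.equivClosedPoints X).injective
    apply Subtype.ext
    rw [ComplexPoints.coe_equivClosedPoints_apply, ComplexPoints.coe_equivClosedPoints_apply]
    change V.ι (IsOpenImmersion.lift jV₀ (B₁.ι ≫ π₂) hβr zb.pt) = b.pt
    have h1 : jV₀ (IsOpenImmersion.lift jV₀ (B₁.ι ≫ π₂) hβr zb.pt) = jV₀ yb := by
      rw [← Scheme.Hom.comp_apply, hβ₀, Scheme.Hom.comp_apply, Scheme.Opens.ι_apply, hzb₁, hπ₂b]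
    rw [jV₀.isOpenEmbedding.injective h1, hyb, ← hbV₁]
    rfl
  /- Step 9: an affine open of `Z` through both points (Segre), and the two-charts lemma. -/
  obtain ⟨n, ιP, hιP⟩ := hPU.tensor hPV
  obtain ⟨ιP₀, hιP₀⟩ : ∃ f : pullback PU.hom PV.hom ⟶ (projectiveSpace n ℂ).left, f = ιP.left := ⟨_, rfl⟩
  haveI : IsClosedImmersion ιP₀ := by rw [hιP₀]; exact hιP
  let imm : Z ⟶ (projectiveSpace n ℂ).left := i ≫ ιP₀
  haveI : IsImmersion imm := by
    haveI : IsClosedImmersion imm := inferInstanceAs (IsClosedImmersion (e.imageι ≫ ιP₀))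
    infer_instance
  obtain ⟨T', hT', hsub⟩ :=
    exists_isAffineOpen_finset_subset_of_isImmersion imm ({zZa.pt, zZb.pt} : Finset Z)
  have haT : A₁.ι za.pt ∈ T' := by
    rw [Scheme.Opens.ι_apply, hza₁]
    exact hsub (Finset.mem_coe.mpr (Finset.mem_insert_self _ _))
  have hbT : B₁.ι zb.pt ∈ T' := by
    rw [Scheme.Opens.ι_apply, hzb₁]
    exact hsub (Finset.mem_coe.mpr (Finset.mem_insert_of_mem (Finset.mem_singleton_self _)))
  obtain ⟨C, g, a', b', hC, hirr, hsm, hdim, ha', hb'⟩ :=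
    TwoCharts.exists_smoothCurve_through_two_charts_of_isAffineOpen (T := Zₒ) A₁ B₁ O₁ hO₁A hO₁B
      hO₁ α₁ β₁ hαβ₁ za zb T' hT' haT hbT
  exact ⟨C, g, a', b', hC, hirr, hsm, hdim, ha'.trans hαza, hb'.trans hβzb⟩

/-- **Mumford's two-point lemma over a smooth irreducible base, no separatedness** — the form consumed
by base-change arguments over smooth irreducible bases (smooth over a field ⇒ reduced ⇒ integral;
smooth ⇒ locally of finite type): any two complex points of a smooth irreducible `ℂ`-scheme lie in the
image of a smooth irreducible affine curve. [cite: MumfordAV1970, §6, Lemma]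
[cite: GortzWedhorn2020, Thm. 13.100] -/
theorem mumford_smoothCurve_through_two_points_of_irreducibleSpace_of_smooth {S : SchemeOver ℂ}
    [IrreducibleSpace S.left] [AlgebraicGeometry.Smooth S.hom] (a b : ComplexPoints S) :
    ∃ (C : SchemeOver ℂ) (g : C ⟶ S) (a' b' : ComplexPoints C),
      IsAffine C.left ∧ IrreducibleSpace C.left ∧ AlgebraicGeometry.Smooth C.hom ∧
        topologicalKrullDim C.left = 1 ∧ AlgPoints.map g a' = a ∧ AlgPoints.map g b' = b := by
  haveI : IsReduced S.left := isReduced_of_smooth_over_field S.hom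
  haveI : IsIntegral S.left := isIntegral_of_irreducibleSpace_of_isReduced S.left
  haveI : LocallyOfFiniteType S.hom := inferInstance
  exact mumford_smoothCurve_through_two_points_of_isIntegral a b

end Literature.AlgebraicGeometry.Motives

end
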